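import Mathlib
import HarnessLib
import Summits.NavierStokesRegularity.NavierStokesRegularity.Theorems.PoloidalWindowRigidity.Negative.ResidueRev9False
import Summits.NavierStokesRegularity.NavierStokesRegularity.Theorems.PoloidalWindowRigidity.Negative.AnyFrameDrift

/-!
# Crux `PoloidalWindowRigidity` (K2, stmt-NavierStokesRegularity-19708) — negative side:
# the rev-9 residue stub S2‴ with (M) ↦ ClassRates is false — FULL hypothesis list, no clause deleted

Negative-side support (refuter seat ns-regularity-refuter1 gen 2, cell ns-regularity-ideate; D-0081 §C).
`…Negative.ResidueRev9False` (p487680) certified the rev-9 stub `stub_residueNoPeriodNoSpiral` of line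
`slicesharp-screw` FALSE when the Oseen-mild identity (M) is replaced by the two scale-sharp ClassRates, with the
any-frame axisymmetry clause deleted.  `…Negative.AnyFrameDrift` (p488496) has since certified that clause for the
witness (`driftProfile_not_axisymmetric_anyFrame`).  This file records the corollary:

* `residueRev9_false_with_classRates_without_mild_full`: **S2‴ — EVERY hypothesis of the rev-9 stub verbatim (rate,
  continuity, divergence-free, poloidal, frozen, the three kinematic exclusions, the translation / ANY-FRAME
  AXISYMMETRY / scale / screw exclusions, the no-source-gauge clause, no vertical period, critical strain (iv), no
  spatial period (v′), no spiral self-similarity (vi′)) except that (M) is replaced by `‖Dv(t)‖ ≤ C₁/(−t)`,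
  `‖curl v(t)‖ ≤ C₂/(−t)` — is FALSE** (witness: the drifting cellular profile, `C = 4, C₁ = 8, C₂ = 4`).

So for rev 9 the census line «(M) is the only load-bearing hypothesis» is a theorem with no caveat.  (For rev 10 the
extra clause (vii) cuts this witness, `…Negative.NearPeakDrift`; the three-wave profile `…Negative.TriWaveProfile`
meets (vii).)  WHAT THIS IS NOT: not a claim about Navier–Stokes — kinematics of an explicit profile. [folklore]
-/

noncomputable section

-- the summit and its single sub-problem share the name (CONVENTIONS §1), as in every Theorems file
set_option linter.dupNamespace false

namespace Summit.NavierStokesRegularity.NavierStokesRegularity.Theorems.PoloidalWindowRigidity.Negative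

open Set Function
open scoped RealInnerProductSpace InnerProductSpace Laplacian
open Literature.Analysis Literature.Analysis.FluidPDE

/-- **The rev-9 residue stub S2‴ with (M) replaced by the ClassRates is FALSE — full hypothesis list** (the any-frame
axisymmetry clause included). [folklore] -/
theorem residueRev9_false_with_classRates_without_mild_full :
    ¬ (∀ (C C₁ C₂ : ℝ) (v : ℝ → EuclideanSpace ℝ (Fin 3) → EuclideanSpace ℝ (Fin 3)),
      Literature.Analysis.FluidPDE.HasTypeITimeDecay C v →
      ContinuousOn (Function.uncurry v) (Set.Iio (0 : ℝ) ×ˢ Set.univ) →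
      (∀ t < 0, ∀ y, ‖fderiv ℝ (v t) y‖ ≤ C₁ / (-t)) →
      (∀ t < 0, ∀ y, ‖Literature.Analysis.FluidPDE.curl (v t) y‖ ≤ C₂ / (-t)) →
      (∀ t < 0, Literature.Analysis.FluidPDE.VectorCalculus.IsDivFree (v t)) →
      (∀ s < 0, ∀ y, ⟪Literature.Analysis.FluidPDE.curl (v s) y, EuclideanSpace.single 2 1⟫_ℝ = 0) →
      (∀ s < 0, ∀ y, ⟪fderiv ℝ (v s) y (Literature.Analysis.FluidPDE.curl (v s) y), EuclideanSpace.single 2 1⟫_ℝ = 0) →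
      (∀ s < 0, ∀ b : EuclideanSpace ℝ (Fin 3), b ≠ 0 → ∃ y,
        Literature.Analysis.FluidPDE.cross (Literature.Analysis.FluidPDE.curl (v s) y) b ≠ 0) →
      (∀ s < 0, ∃ y, fderiv ℝ (v s) y (EuclideanSpace.single 2 1) 0 ≠ 0 ∨
        fderiv ℝ (v s) y (EuclideanSpace.single 2 1) 1 ≠ 0) →
      (∀ s < 0, ∀ a : EuclideanSpace ℝ (Fin 3), a ≠ 0 → ⟪a, EuclideanSpace.single 2 1⟫_ℝ = 0 →
        ∃ y, ⟪fderiv ℝ (v s) y a, EuclideanSpace.single 2 1⟫_ℝ ≠ 0) →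
      (∀ s < 0, ∀ e : EuclideanSpace ℝ (Fin 3), e ≠ 0 → ∃ (y : EuclideanSpace ℝ (Fin 3)) (l : ℝ), v s (y + l • e) ≠ v s y) →
      (∀ s < 0, ∀ (L : EuclideanSpace ℝ (Fin 3) ≃ₗᵢ[ℝ] EuclideanSpace ℝ (Fin 3)) (c : EuclideanSpace ℝ (Fin 3)),
        ¬ Literature.Analysis.FluidPDE.IsAxisymmetric (fun y => L.symm (v s (L y + c)))) →
      (∃ lam : ℝ, 0 < lam ∧ ∃ s < 0, ∃ y, lam • v (lam ^ 2 * s) (lam • y) ≠ v s y) →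
      (∀ κ : ℝ, κ ≠ 0 → ∀ c : EuclideanSpace ℝ (Fin 3), ∃ s < 0, ∃ (a : ℝ) (y : EuclideanSpace ℝ (Fin 3)),
        v s (c + Literature.Analysis.FluidPDE.rotZ (κ * a) (y - c) + a • EuclideanSpace.single 2 (1 : ℝ)) ≠
          Literature.Analysis.FluidPDE.rotZ (κ * a) (v s y)) →
      (∀ (ψ : ℝ → EuclideanSpace ℝ (Fin 3) → ℝ) (src : ℝ → ℝ) (x₀ : EuclideanSpace ℝ (Fin 3)) (ε : ℝ → ℝ),
        ContDiffOn ℝ 2 (Function.uncurry ψ) (Set.Iio (0 : ℝ) ×ˢ Set.univ) →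
        (∀ t < 0, ∀ y, Literature.Analysis.FluidPDE.curl (v t) y 0 = fderiv ℝ (ψ t) y (EuclideanSpace.single 1 1) ∧
          Literature.Analysis.FluidPDE.curl (v t) y 1 = -fderiv ℝ (ψ t) y (EuclideanSpace.single 0 1)) →
        (∀ t < 0, ∀ x, |ψ t x - ψ t x₀| ≤ ε t * ‖x - x₀‖) →
        ContinuousOn ε (Set.Iio 0) →
        Filter.Tendsto (fun t => ε t * Real.sqrt (-t)) Filter.atBot (nhds 0) →
        ∃ t < 0, ∃ x, deriv (fun τ => ψ τ x) t + fderiv ℝ (ψ t) x (v t x) - (Δ (ψ t)) x ≠ src t) →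
      (∀ L : ℝ, 0 < L → ∃ s < 0, ∃ y, v s (y + L • EuclideanSpace.single 2 (1 : ℝ)) ≠ v s y) →
      (∀ Λ : ℝ, Λ < 1 → ∃ s < 0, ∃ (y a : EuclideanSpace ℝ (Fin 3)), ⟪a, EuclideanSpace.single 2 (1 : ℝ)⟫_ℝ = 0 ∧
        Λ * ‖a‖ ^ 2 < (-s) * ⟪fderiv ℝ (v s) y a, a⟫_ℝ) →
      (∀ ℓ : EuclideanSpace ℝ (Fin 3), ℓ ≠ 0 → ∃ s < 0, ∃ y, v s (y + ℓ) ≠ v s y) →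
      (∀ (c : EuclideanSpace ℝ (Fin 3)) (κ : ℝ), ∃ (r : ℝ), ∃ s < 0, ∃ y,
        Real.exp r • v (Real.exp r ^ 2 * s) (Real.exp r • Literature.Analysis.FluidPDE.rotZ (κ * r) y + c) ≠
          Literature.Analysis.FluidPDE.rotZ (κ * r) (v s (y + c))) →
      ¬ Literature.Analysis.FluidPDE.IsBackwardSingularPoint v 0) := by
  intro h
  refine h 4 8 4 driftProfile hasTypeITimeDecay_driftProfile continuousOn_driftProfile
    (fun t ht y => norm_fderiv_driftProfile_le ht y) (fun t ht y => norm_curl_driftProfile_le ht y)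
    (fun t _ => isDivFree_driftProfile t) (fun s _ y => poloidal_driftProfile s y)
    (fun s _ y => frozen_driftProfile s y)
    (fun s hs b hb => vorticityDirection_nonconstant_driftProfile hs b hb)
    (fun s hs => (not_vertRigid_driftProfile hs).imp fun _ h => Or.inl h)
    (fun s hs a ha ha2 => flat_in_no_horizontal_direction_driftProfile hs a ha ha2)
    (fun s hs e he => not_translationInvariant_driftProfile hs e he)
    (fun s hs L c => driftProfile_not_axisymmetric_anyFrame hs L c)
    ⟨2, two_pos, -1, by norm_num, 0, not_scaleInvariant_driftProfile⟩
    (fun κ _ c => ⟨-1, by norm_num, Real.pi / 2, not_screwInvariant_driftProfile (κ * (Real.pi / 2)) c⟩)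
    (fun ψ src _ _ hψ hstr _ _ _ => noSourceGauge_driftProfile ψ src hψ hstr)
    (fun L hL => driftProfile_no_vertical_period L hL)
    (fun Λ hΛ => driftProfile_critical_strain Λ hΛ)
    (fun ℓ hℓ => driftProfile_no_common_period ℓ hℓ)
    (fun c κ => not_spiralSelfSimilar_driftProfile c κ)
    isBackwardSingularPoint_driftProfile

end Summit.NavierStokesRegularity.NavierStokesRegularity.Theorems.PoloidalWindowRigidity.Negative

end
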